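import Summits.BirchSwinnertonDyer.BirchSwinnertonDyer.Theorems.QuadraticBranchSignedControlPlusEtaNonsurjUncongruentRecordsFine01
import Summits.BirchSwinnertonDyer.BirchSwinnertonDyer.Theorems.QuadraticBranchSignedControlPlusEtaNonsurjUncongruentRecordsSeven01
import Summits.BirchSwinnertonDyer.BirchSwinnertonDyer.Theorems.QuadraticBranchSignedControlPlusEtaNonsurjUncongruentRecordsSeven02
import Summits.BirchSwinnertonDyer.BirchSwinnertonDyer.Theorems.QuadraticBranchSignedControlPlusEtaNonsurjUncongruentTwistInvariance
import Summits.BirchSwinnertonDyer.Rank1Residual.Additive.QuadraticBranchPlusEtaNodes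
import HarnessLib

/-!
# Route `QuadraticBranchSignedControl` (rung K8, cell `bsd-potss`): crux stmt-BirchSwinnertonDyer-19606
# `PlusEtaMainConjectureNonsurj` — the `j`-CLASSES of five uncongruent rows are, member by member, rows of the v7 stub
# `stub_etaMC_nonCM_uncongruent`'s domain (the census populations of seat `bsd-potss-k8eta-c2` g19, BY NAME)

WHAT. Skeleton v7 (`Cruxes/PlusEtaMainConjectureNonsurj/Lines/birth.lean`, 39fd0f5855aa) isolates the open class-wide residue of crux 19606
in ONE stub, `stub_etaMC_nonCM_uncongruent`: (C1⁺_η) for every globally minimal `V`, good supersingular at `p ≥ 5` with `a_p = 0`, whose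
`p`-adic tower is not onto, which is NOT CM and NOT `p`-congruent to any CM row. Seat g19 measured the analytic Iwasawa invariants of
`L_p^±(V, η, X)` on the quadratic-twist FAMILIES `V = A^{(D)}` of five such rows `A` (kit «etanc», jobs j317301 / j317312 / j317319 /
j317451 / j317464): `A` = the `X_ns⁺(5)` rows `t = 4/5` (N = 43659) and `t = 3` (N = 81356) of the height-20 table (kernel records
`EtaUncongruentRecords.uncongruent_4_5`, `uncongruent_3`, p630825) and the `X_ns⁺(7)` rows `x = 1/3` (N = 15341), `x = −1/3` (N = 39325),
`x = 4` (N = 65533) (`EtaUncongruentRecordsSeven.uncongruent7_1_3`, `uncongruent7_m1_3`, `uncongruent7_4`, g15). THIS FILE records, in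
the kernel, that every member of these census populations — indeed every globally minimal curve `V'` good at `p` with `j(V') = j(A)` — satisfies
ALL the hypotheses of the stub at `(V', p)`: `a_p(V') = 0`, tower not onto, `¬ CM`, and NO CM anchor (§1 generic transport by `j` =
g15's `EtaCartanField.row_of_j_eq_of_not_hasCM` + `not_exists_cmAnchor_iff_of_j_eq_of_not_hasCM` + `not_hasCM_of_not_exists_cmAnchor`;
§2 the five classes with `j(A)` evaluated, good reduction and `a_p(A) = 0` from point counts; §3 the stub's TEXT, restricted to such a class,
delivers (C1⁺_η) for every member). The ONE displayed input per class is the non-surjectivity of `A`'s own `p`-adic tower (`hnsA`, as in the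
records: Zywina's classification is cited, not kernel-checked).

HONEST FRAMING (cell `bsd-potss`, run/shared/lean/pub/bsd-potss/; FULL-BSD rank ≤ 1 programme, HUMAN RULING D-0036/D-0074): BOOKKEEPING /
CLASSIFICATION theorems only — no definition, no named Literature fact, no Summits-side `def … : Prop`, no `sorry`, axioms standard. (C1⁺_η) is
proved for NO curve here; §3 is CONDITIONAL on the stub's text (hypothesis position = the open class-wide statement itself). Crux 19606 and the
stub stay OPEN; nothing is booked; `BSD(W, p)` for no pair. Seat `bsd-potss-k8eta-c2` g19, `--supports stmt-BirchSwinnertonDyer-19606`.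

References: [Zywina2015] Thm. 1.4 and §4.5 (images `C_ns⁺(5)`, `C_ns⁺(7)`); [SilvermanAEC2009] X.5 Prop. 5.4 / Cor. 5.4.1 (twists and `j`),
VII.5 Prop. 5.1; [Kobayashi2003] §4 Even main conjecture (p. 8; the node (C1⁺_η), shape only).
-/

set_option autoImplicit false
set_option linter.dupNamespace false

noncomputable section

open scoped Classical

open WeierstrassCurve Literature.NumberTheory.EllipticCurves Literature.NumberTheory.EllipticCurves.Rank1Residual
  Literature.NumberTheory.EllipticCurves.Rank1Residual.X11RankOneCertificates
  Summit.BirchSwinnertonDyer.Rank1Residual.X11b Summit.BirchSwinnertonDyer.BirchSwinnertonDyer.Rank1Residual.IntModel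
  Summit.BirchSwinnertonDyer.BirchSwinnertonDyer.Rank1Residual.X11RankOne
open Summit.BirchSwinnertonDyer.Rank1Residual.O6 (ModPCongruent)
open Summit.BirchSwinnertonDyer.Rank1Residual.Additive (QuadraticBranchPlusEtaMainConjectureAt)

namespace Summit.BirchSwinnertonDyer.BirchSwinnertonDyer.Theorems.EtaUncongruentFamilies

open Summit.BirchSwinnertonDyer.BirchSwinnertonDyer.Theorems.EtaCartanField
open Summit.BirchSwinnertonDyer.BirchSwinnertonDyer.Theorems.EtaUncongruentRecords
open Summit.BirchSwinnertonDyer.BirchSwinnertonDyer.Theorems.EtaUncongruentRecordsSeven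

/-! ## §1 Generic transport: the `j`-class of an uncongruent non-CM row lies in the stub's domain -/

/-- **The whole `j`-class of an uncongruent row is in the domain of `stub_etaMC_nonCM_uncongruent`.** Let `A` be a row of crux 19606 at an
odd prime `p` (globally minimal, good at `p`, `a_p(A) = 0`, `p`-adic tower not onto) with NO CM anchor at `p`. Then every globally minimal
`V'` good at `p` with `j(V') = j(A)` has `a_p(V') = 0`, a non-onto tower, is non-CM, and has no CM anchor at `p` — g15's transport by `j`
(`row_of_j_eq_of_not_hasCM`, `not_exists_cmAnchor_iff_of_j_eq_of_not_hasCM`), `A` being non-CM because it is its own would-be anchor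
(`not_hasCM_of_not_exists_cmAnchor`). In particular every globally minimal model of a quadratic twist `A^{(D)}` with `p ∤ D` qualifies.
[cite: SilvermanAEC2009, X.5 Prop. 5.4 and Cor. 5.4.1, VII.5 Prop. 5.1] -/
theorem stubDomain_of_j_eq (A V' : WeierstrassCurve ℚ) [A.IsElliptic] [A.IsGloballyMinimal] [V'.IsElliptic]
    [V'.IsGloballyMinimal] (p : ℕ) [Fact p.Prime] (hp2 : p ≠ 2)
    (hgoodA : A.HasGoodReductionAtPrime p) (hapA : A.frobeniusTrace p = 0)
    (hnsA : ¬ ∀ m : ℕ, A.HasSurjectiveModNGaloisRep (p ^ m : ℕ))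
    (hnoA : ¬ ∃ (V'' : WeierstrassCurve ℚ) (_ : V''.IsElliptic) (_ : V''.IsGloballyMinimal),
        V''.HasCM ∧ V''.HasGoodReductionAtPrime p ∧ V''.frobeniusTrace p = 0 ∧ ModPCongruent V'' A p)
    (hgood' : V'.HasGoodReductionAtPrime p) (hj : V'.j = A.j) :
    V'.frobeniusTrace p = 0 ∧ (¬ ∀ m : ℕ, V'.HasSurjectiveModNGaloisRep (p ^ m : ℕ)) ∧ ¬ V'.HasCM ∧
      ¬ ∃ (V'' : WeierstrassCurve ℚ) (_ : V''.IsElliptic) (_ : V''.IsGloballyMinimal),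
        V''.HasCM ∧ V''.HasGoodReductionAtPrime p ∧ V''.frobeniusTrace p = 0 ∧ ModPCongruent V'' V' p := by
  have hCMA : ¬ A.HasCM := not_hasCM_of_not_exists_cmAnchor A p hgoodA hapA hnoA
  obtain ⟨hap', hns', hCM'⟩ := row_of_j_eq_of_not_hasCM A V' p hp2 hCMA hj hgoodA hgood' hapA hnsA
  exact ⟨hap', hns', hCM', (not_exists_cmAnchor_iff_of_j_eq_of_not_hasCM A V' p hp2 hCMA hj hgoodA hgood').1.mp hnoA⟩

/-- **The stub's TEXT, restricted to the `j`-class of an uncongruent row, gives (C1⁺_η) for every member** (CONDITIONAL on that text — the open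
class-wide statement `Sig.stub_etaMC_nonCM_uncongruent` of skeleton v7, verbatim in hypothesis position; nothing is proved about it).
[cite: Kobayashi2003, §4 Even main conjecture (p. 8); shape only] [cite: SilvermanAEC2009, X.5 Cor. 5.4.1] -/
theorem plusEtaAt_of_stubText_of_j_eq
    (hstub : ∀ (V : WeierstrassCurve ℚ) [V.IsElliptic] [V.IsGloballyMinimal] (p : ℕ) [Fact p.Prime],
      5 ≤ p → V.HasGoodReductionAtPrime p → V.frobeniusTrace p = 0 →
      ¬ (∀ m : ℕ, V.HasSurjectiveModNGaloisRep (p ^ m : ℕ)) → ¬ V.HasCM →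
      ¬ (∃ (V'' : WeierstrassCurve ℚ) (_ : V''.IsElliptic) (_ : V''.IsGloballyMinimal),
          V''.HasCM ∧ V''.HasGoodReductionAtPrime p ∧ V''.frobeniusTrace p = 0 ∧ ModPCongruent V'' V p) →
      QuadraticBranchPlusEtaMainConjectureAt V p)
    (A V' : WeierstrassCurve ℚ) [A.IsElliptic] [A.IsGloballyMinimal] [V'.IsElliptic] [V'.IsGloballyMinimal]
    (p : ℕ) [Fact p.Prime] (hp5 : 5 ≤ p)
    (hgoodA : A.HasGoodReductionAtPrime p) (hapA : A.frobeniusTrace p = 0)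
    (hnsA : ¬ ∀ m : ℕ, A.HasSurjectiveModNGaloisRep (p ^ m : ℕ))
    (hnoA : ¬ ∃ (V'' : WeierstrassCurve ℚ) (_ : V''.IsElliptic) (_ : V''.IsGloballyMinimal),
        V''.HasCM ∧ V''.HasGoodReductionAtPrime p ∧ V''.frobeniusTrace p = 0 ∧ ModPCongruent V'' A p)
    (hgood' : V'.HasGoodReductionAtPrime p) (hj : V'.j = A.j) :
    QuadraticBranchPlusEtaMainConjectureAt V' p := by
  have hp2 : p ≠ 2 := by omega
  obtain ⟨hap', hns', hCM', hno'⟩ := stubDomain_of_j_eq A V' p hp2 hgoodA hapA hnsA hnoA hgood' hj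
  exact hstub V' p hp5 hgood' hap' hns' hCM' hno'

/-! ## §2 The five `j`-classes of the g19 census (uncongruent bases at `p = 5` and `p = 7`) -/

/-- `j(t = 4/5) = 256611522375 / 161051` (`= 3²·5³·13³·47³ / 11⁵`; `A = [1,−1,1,−4010,98676]`, N = 43659). [cite: Zywina2015, Thm. 1.4] -/
theorem j_4_5 : @WeierstrassCurve.j ℚ _ ⟨1, -1, 1, -4010, 98676⟩ isElliptic_4_5 = 256611522375 / 161051 := by
  rw [@j_eq_c₄_pow_div _ isElliptic_4_5]; norm_num [WeierstrassCurve.c₄, WeierstrassCurve.b₂, WeierstrassCurve.b₄,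
    WeierstrassCurve.Δ, WeierstrassCurve.b₆, WeierstrassCurve.b₈]

/-- `j(t = 3) = 296352000 / 161051` (`= 2⁸·3³·5³·7³ / 11⁵`; `A = [0,0,0,−1505,−5547]`, N = 81356). [cite: Zywina2015, Thm. 1.4] -/
theorem j_3 : @WeierstrassCurve.j ℚ _ ⟨0, 0, 0, -1505, -5547⟩ isElliptic_3 = 296352000 / 161051 := by
  rw [@j_eq_c₄_pow_div _ isElliptic_3]; norm_num [WeierstrassCurve.c₄, WeierstrassCurve.b₂, WeierstrassCurve.b₄,
    WeierstrassCurve.Δ, WeierstrassCurve.b₆, WeierstrassCurve.b₈]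

/-- `j(x = 1/3) = −9528128000000 / 17249876309` (`= −2¹²·5⁶·53³ / 29⁷`; `A = [0,−1,1,−10158,804091]`, N = 15341). [cite: Zywina2015, §4.5] -/
theorem j_1_3 : @WeierstrassCurve.j ℚ _ ⟨0, -1, 1, -10158, 804091⟩ isElliptic_1_3 = -9528128000000 / 17249876309 := by
  rw [@j_eq_c₄_pow_div _ isElliptic_1_3]; norm_num [WeierstrassCurve.c₄, WeierstrassCurve.b₂, WeierstrassCurve.b₄,
    WeierstrassCurve.Δ, WeierstrassCurve.b₆, WeierstrassCurve.b₈]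

/-- `j(x = −1/3) = 106227040256 / 62748517` (`= 2²¹·37³ / 13⁷`; `A = [0,1,1,5427,23964]`, N = 39325). [cite: Zywina2015, §4.5] -/
theorem j_m1_3 : @WeierstrassCurve.j ℚ _ ⟨0, 1, 1, 5427, 23964⟩ EtaUncongruentRecordsSeven.isElliptic_m1_3 = 106227040256 / 62748517 := by
  rw [@j_eq_c₄_pow_div _ EtaUncongruentRecordsSeven.isElliptic_m1_3]; norm_num [WeierstrassCurve.c₄, WeierstrassCurve.b₂, WeierstrassCurve.b₄,
    WeierstrassCurve.Δ, WeierstrassCurve.b₆, WeierstrassCurve.b₈]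

/-- `j(x = 4) = −1958755401728 / 62748517` (`= −2¹⁵·17³·23³ / 13⁷`; `A = [0,−1,1,−18507,−989382]`, N = 65533). [cite: Zywina2015, §4.5] -/
theorem j_4 : @WeierstrassCurve.j ℚ _ ⟨0, -1, 1, -18507, -989382⟩ isElliptic_4 = -1958755401728 / 62748517 := by
  rw [@j_eq_c₄_pow_div _ isElliptic_4]; norm_num [WeierstrassCurve.c₄, WeierstrassCurve.b₂, WeierstrassCurve.b₄,
    WeierstrassCurve.Δ, WeierstrassCurve.b₆, WeierstrassCurve.b₈]

set_option maxRecDepth 100000 in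
/-- **Class `t = 4/5` at `p = 5`** (`K_V = ℚ(√−7)`, h = 1, no CM anchor: `uncongruent_4_5`): every globally minimal `V'` good at `5` with
`j(V') = 256611522375/161051` is a non-CM uncongruent row at `5` — granted the non-surjectivity of `A`'s `5`-adic tower (displayed).
Good reduction and `a_5(A) = 0` from the count `#A(𝔽_5) = 6` (kernel). [cite: Zywina2015, Thm. 1.4] [cite: SilvermanAEC2009, X.5 Cor. 5.4.1] -/
theorem stubDomain_class_4_5 [Fact (5 : ℕ).Prime] (A : WeierstrassCurve ℚ) [A.IsElliptic] [A.IsGloballyMinimal]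
    (hA : A = ⟨1, -1, 1, -4010, 98676⟩) (hnsA : ¬ ∀ m : ℕ, A.HasSurjectiveModNGaloisRep (5 ^ m : ℕ))
    (V' : WeierstrassCurve ℚ) [V'.IsElliptic] [V'.IsGloballyMinimal] (hgood' : V'.HasGoodReductionAtPrime 5)
    (hj : V'.j = 256611522375 / 161051) :
    V'.frobeniusTrace 5 = 0 ∧ (¬ ∀ m : ℕ, V'.HasSurjectiveModNGaloisRep (5 ^ m : ℕ)) ∧ ¬ V'.HasCM ∧
      ¬ ∃ (V'' : WeierstrassCurve ℚ) (_ : V''.IsElliptic) (_ : V''.IsGloballyMinimal),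
        V''.HasCM ∧ V''.HasGoodReductionAtPrime 5 ∧ V''.frobeniusTrace 5 = 0 ∧ ModPCongruent V'' V' 5 := by
  have hnoA := uncongruent_4_5 A hA hnsA
  subst hA
  have hI : integralModelInt (⟨1, -1, 1, -4010, 98676⟩ : WeierstrassCurve ℚ) = ⟨1, -1, 1, -4010, 98676⟩ :=
    integralModelInt_eq_of_map_eq _ (map_mk_int (1) (-1) (1) (-4010) (98676))
  obtain ⟨hgoodA, htr⟩ := good_and_frobeniusTrace_eq_of_countPoints hI 5 (by norm_num) (by decide +kernel)
  have hc : countPoints [1, -1, 1, -4010, 98676] 5 = 6 := by decide +kernel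
  have hapA : WeierstrassCurve.frobeniusTrace ⟨1, -1, 1, -4010, 98676⟩ 5 = 0 := by rw [htr, hc]; norm_num
  have hjA : WeierstrassCurve.j (⟨1, -1, 1, -4010, 98676⟩ : WeierstrassCurve ℚ) = 256611522375 / 161051 := by
    rw [← j_4_5]
  exact stubDomain_of_j_eq _ V' 5 (by norm_num) hgoodA hapA hnsA hnoA hgood' (hj.trans hjA.symm)

set_option maxRecDepth 100000 in
/-- **Class `t = 3` at `p = 5`** (`K_V = ℚ(√−43)`, h = 1, no CM anchor: `uncongruent_3`): every globally minimal `V'` good at `5` with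
`j(V') = 296352000/161051` is a non-CM uncongruent row at `5` — granted the non-surjectivity of `A`'s `5`-adic tower (displayed); `#A(𝔽_5) = 6`.
[cite: Zywina2015, Thm. 1.4] [cite: SilvermanAEC2009, X.5 Cor. 5.4.1] -/
theorem stubDomain_class_3 [Fact (5 : ℕ).Prime] (A : WeierstrassCurve ℚ) [A.IsElliptic] [A.IsGloballyMinimal]
    (hA : A = ⟨0, 0, 0, -1505, -5547⟩) (hnsA : ¬ ∀ m : ℕ, A.HasSurjectiveModNGaloisRep (5 ^ m : ℕ))
    (V' : WeierstrassCurve ℚ) [V'.IsElliptic] [V'.IsGloballyMinimal] (hgood' : V'.HasGoodReductionAtPrime 5)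
    (hj : V'.j = 296352000 / 161051) :
    V'.frobeniusTrace 5 = 0 ∧ (¬ ∀ m : ℕ, V'.HasSurjectiveModNGaloisRep (5 ^ m : ℕ)) ∧ ¬ V'.HasCM ∧
      ¬ ∃ (V'' : WeierstrassCurve ℚ) (_ : V''.IsElliptic) (_ : V''.IsGloballyMinimal),
        V''.HasCM ∧ V''.HasGoodReductionAtPrime 5 ∧ V''.frobeniusTrace 5 = 0 ∧ ModPCongruent V'' V' 5 := by
  have hnoA := uncongruent_3 A hA hnsA
  subst hA
  have hI : integralModelInt (⟨0, 0, 0, -1505, -5547⟩ : WeierstrassCurve ℚ) = ⟨0, 0, 0, -1505, -5547⟩ :=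
    integralModelInt_eq_of_map_eq _ (map_mk_int (0) (0) (0) (-1505) (-5547))
  obtain ⟨hgoodA, htr⟩ := good_and_frobeniusTrace_eq_of_countPoints hI 5 (by norm_num) (by decide +kernel)
  have hc : countPoints [0, 0, 0, -1505, -5547] 5 = 6 := by decide +kernel
  have hapA : WeierstrassCurve.frobeniusTrace ⟨0, 0, 0, -1505, -5547⟩ 5 = 0 := by rw [htr, hc]; norm_num
  have hjA : WeierstrassCurve.j (⟨0, 0, 0, -1505, -5547⟩ : WeierstrassCurve ℚ) = 296352000 / 161051 := by rw [← j_3]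
  exact stubDomain_of_j_eq _ V' 5 (by norm_num) hgoodA hapA hnsA hnoA hgood' (hj.trans hjA.symm)

set_option maxRecDepth 100000 in
/-- **Class `x = 1/3` at `p = 7`** (`h(K_V) = 3`, no CM anchor: `uncongruent7_1_3`): every globally minimal `V'` good at `7` with
`j(V') = −9528128000000/17249876309` is a non-CM uncongruent row at `7` — granted the non-surjectivity of `A`'s `7`-adic tower (displayed);
`#A(𝔽_7) = 8`. [cite: Zywina2015, §4.5] [cite: SilvermanAEC2009, X.5 Cor. 5.4.1] -/
theorem stubDomain_class_1_3 [Fact (7 : ℕ).Prime] (A : WeierstrassCurve ℚ) [A.IsElliptic] [A.IsGloballyMinimal]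
    (hA : A = ⟨0, -1, 1, -10158, 804091⟩) (hnsA : ¬ ∀ m : ℕ, A.HasSurjectiveModNGaloisRep (7 ^ m : ℕ))
    (V' : WeierstrassCurve ℚ) [V'.IsElliptic] [V'.IsGloballyMinimal] (hgood' : V'.HasGoodReductionAtPrime 7)
    (hj : V'.j = -9528128000000 / 17249876309) :
    V'.frobeniusTrace 7 = 0 ∧ (¬ ∀ m : ℕ, V'.HasSurjectiveModNGaloisRep (7 ^ m : ℕ)) ∧ ¬ V'.HasCM ∧
      ¬ ∃ (V'' : WeierstrassCurve ℚ) (_ : V''.IsElliptic) (_ : V''.IsGloballyMinimal),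
        V''.HasCM ∧ V''.HasGoodReductionAtPrime 7 ∧ V''.frobeniusTrace 7 = 0 ∧ ModPCongruent V'' V' 7 := by
  have hnoA := uncongruent7_1_3 A hA hnsA
  subst hA
  have hI : integralModelInt (⟨0, -1, 1, -10158, 804091⟩ : WeierstrassCurve ℚ) = ⟨0, -1, 1, -10158, 804091⟩ :=
    integralModelInt_eq_of_map_eq _ (map_mk_int (0) (-1) (1) (-10158) (804091))
  obtain ⟨hgoodA, htr⟩ := good_and_frobeniusTrace_eq_of_countPoints hI 7 (by norm_num) (by decide +kernel)
  have hc : countPoints [0, -1, 1, -10158, 804091] 7 = 8 := by decide +kernel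
  have hapA : WeierstrassCurve.frobeniusTrace ⟨0, -1, 1, -10158, 804091⟩ 7 = 0 := by rw [htr, hc]; norm_num
  have hjA : WeierstrassCurve.j (⟨0, -1, 1, -10158, 804091⟩ : WeierstrassCurve ℚ) = -9528128000000 / 17249876309 := by
    rw [← j_1_3]
  exact stubDomain_of_j_eq _ V' 7 (by norm_num) hgoodA hapA hnsA hnoA hgood' (hj.trans hjA.symm)

set_option maxRecDepth 100000 in
/-- **Class `x = −1/3` at `p = 7`** (`K_V = ℚ(√−11)`, h = 1, no CM anchor by the fine door: `uncongruent7_m1_3`): every globally minimal `V'`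
good at `7` with `j(V') = 106227040256/62748517` is a non-CM uncongruent row at `7` — granted the non-surjectivity of `A`'s `7`-adic tower
(displayed); `#A(𝔽_7) = 8`. [cite: Zywina2015, §4.5] [cite: SilvermanAEC2009, X.5 Cor. 5.4.1] -/
theorem stubDomain_class_m1_3 [Fact (7 : ℕ).Prime] (A : WeierstrassCurve ℚ) [A.IsElliptic] [A.IsGloballyMinimal]
    (hA : A = ⟨0, 1, 1, 5427, 23964⟩) (hnsA : ¬ ∀ m : ℕ, A.HasSurjectiveModNGaloisRep (7 ^ m : ℕ))
    (V' : WeierstrassCurve ℚ) [V'.IsElliptic] [V'.IsGloballyMinimal] (hgood' : V'.HasGoodReductionAtPrime 7)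
    (hj : V'.j = 106227040256 / 62748517) :
    V'.frobeniusTrace 7 = 0 ∧ (¬ ∀ m : ℕ, V'.HasSurjectiveModNGaloisRep (7 ^ m : ℕ)) ∧ ¬ V'.HasCM ∧
      ¬ ∃ (V'' : WeierstrassCurve ℚ) (_ : V''.IsElliptic) (_ : V''.IsGloballyMinimal),
        V''.HasCM ∧ V''.HasGoodReductionAtPrime 7 ∧ V''.frobeniusTrace 7 = 0 ∧ ModPCongruent V'' V' 7 := by
  have hnoA := uncongruent7_m1_3 A hA hnsA
  subst hA
  have hI : integralModelInt (⟨0, 1, 1, 5427, 23964⟩ : WeierstrassCurve ℚ) = ⟨0, 1, 1, 5427, 23964⟩ :=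
    integralModelInt_eq_of_map_eq _ (map_mk_int (0) (1) (1) (5427) (23964))
  obtain ⟨hgoodA, htr⟩ := good_and_frobeniusTrace_eq_of_countPoints hI 7 (by norm_num) (by decide +kernel)
  have hc : countPoints [0, 1, 1, 5427, 23964] 7 = 8 := by decide +kernel
  have hapA : WeierstrassCurve.frobeniusTrace ⟨0, 1, 1, 5427, 23964⟩ 7 = 0 := by rw [htr, hc]; norm_num
  have hjA : WeierstrassCurve.j (⟨0, 1, 1, 5427, 23964⟩ : WeierstrassCurve ℚ) = 106227040256 / 62748517 := by rw [← j_m1_3]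
  exact stubDomain_of_j_eq _ V' 7 (by norm_num) hgoodA hapA hnsA hnoA hgood' (hj.trans hjA.symm)

set_option maxRecDepth 100000 in
/-- **Class `x = 4` at `p = 7`** (`h(K_V) = 7`, no CM anchor: `uncongruent7_4`): every globally minimal `V'` good at `7` with
`j(V') = −1958755401728/62748517` is a non-CM uncongruent row at `7` — granted the non-surjectivity of `A`'s `7`-adic tower (displayed);
`#A(𝔽_7) = 8`. [cite: Zywina2015, §4.5] [cite: SilvermanAEC2009, X.5 Cor. 5.4.1] -/
theorem stubDomain_class_4 [Fact (7 : ℕ).Prime] (A : WeierstrassCurve ℚ) [A.IsElliptic] [A.IsGloballyMinimal]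
    (hA : A = ⟨0, -1, 1, -18507, -989382⟩) (hnsA : ¬ ∀ m : ℕ, A.HasSurjectiveModNGaloisRep (7 ^ m : ℕ))
    (V' : WeierstrassCurve ℚ) [V'.IsElliptic] [V'.IsGloballyMinimal] (hgood' : V'.HasGoodReductionAtPrime 7)
    (hj : V'.j = -1958755401728 / 62748517) :
    V'.frobeniusTrace 7 = 0 ∧ (¬ ∀ m : ℕ, V'.HasSurjectiveModNGaloisRep (7 ^ m : ℕ)) ∧ ¬ V'.HasCM ∧
      ¬ ∃ (V'' : WeierstrassCurve ℚ) (_ : V''.IsElliptic) (_ : V''.IsGloballyMinimal),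
        V''.HasCM ∧ V''.HasGoodReductionAtPrime 7 ∧ V''.frobeniusTrace 7 = 0 ∧ ModPCongruent V'' V' 7 := by
  have hnoA := uncongruent7_4 A hA hnsA
  subst hA
  have hI : integralModelInt (⟨0, -1, 1, -18507, -989382⟩ : WeierstrassCurve ℚ) = ⟨0, -1, 1, -18507, -989382⟩ :=
    integralModelInt_eq_of_map_eq _ (map_mk_int (0) (-1) (1) (-18507) (-989382))
  obtain ⟨hgoodA, htr⟩ := good_and_frobeniusTrace_eq_of_countPoints hI 7 (by norm_num) (by decide +kernel)
  have hc : countPoints [0, -1, 1, -18507, -989382] 7 = 8 := by decide +kernel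
  have hapA : WeierstrassCurve.frobeniusTrace ⟨0, -1, 1, -18507, -989382⟩ 7 = 0 := by rw [htr, hc]; norm_num
  have hjA : WeierstrassCurve.j (⟨0, -1, 1, -18507, -989382⟩ : WeierstrassCurve ℚ) = -1958755401728 / 62748517 := by
    rw [← j_4]
  exact stubDomain_of_j_eq _ V' 7 (by norm_num) hgoodA hapA hnsA hnoA hgood' (hj.trans hjA.symm)

end Summit.BirchSwinnertonDyer.BirchSwinnertonDyer.Theorems.EtaUncongruentFamilies

end
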